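import Literature.AlgebraicGeometry.Resolution.RegularLocalOrderValuation
import Mathlib.RingTheory.AdjoinRoot
import Mathlib.RingTheory.Flat.FaithfullyFlat.Algebra
import Mathlib.RingTheory.Ideal.GoingUp
import Mathlib.RingTheory.LocalRing.ResidueField.Basic
import Mathlib.RingTheory.Localization.AtPrime.Basic
import Mathlib.RingTheory.Localization.Ideal
import Mathlib.RingTheory.Polynomial.Basic
import Mathlib.RingTheory.PrincipalIdealDomain
import HarnessLib

/-!
# The order of an element of a local ring does not change in the local rings of `𝔸¹` over the closed point —
# commutative-algebra kernel for clause (c10) `IotaTorusFactorMonotone` of the H2a″ design, door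
# `HypersurfaceCentreConstruction` (stmt-ResolutionOfSingularities-19897), route `WeightedInvariant`

[OURS · L1 W4.3 · cell `res-hironaka`, HUMAN RULING D-0089] Helper file `--supports stmt-ResolutionOfSingularities-19897`
written on res-L1-w43-plan-1's ORDER (o11) 2026-08-27T05:00:08Z («FIRST ι-INSTANCE, the ORDER FUNCTION»; clause (c10):
«the order does not grow in `S[X]_𝔮`, `𝔮 ∩ S = 𝔪`» — the points of `{y} × 𝔾ₘ ⊂ B₋ = (Y ∖ Z) × 𝔾ₘ` replacing a point `y`
off the centre of a cobordant blow-up). Typer res-type-073. AI-produced, weaker than expert review. NOT a statement of the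
manuscript under review (Hironaka 2017); nothing here is attributed to its author; nothing here is a claim about resolution
of singularities. Pure commutative algebra; the consumer `WeightedInvariantIotaOrder.lean` transports it to the
`Ordinal`-valued class function `iotaOrd`.

**Theorem** (`mem_maximalIdeal_pow_of_mul_C_mem_pow`, `adicOrder_algebraMap_C`): let `(S, 𝔪, k)` be ANY local ring,
`𝔮 ⊂ S[X]` a prime ideal with `𝔮 ∩ S = 𝔪` (a point of the fibre `𝔸¹_k` over the closed point) and `B = S[X]_𝔮` with
maximal ideal `𝔫`. Then for `f ∈ S` and every `n`, `f ∈ 𝔫ⁿ ⟺ f ∈ 𝔪ⁿ`; i.e. `ord_𝔫(f) = ord_𝔪(f)` (the tree's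
`adicOrder`). No Noetherian, integrality or regularity hypothesis on `S` is used. (For NOETHERIAN `S` this is the special
case `B = S[X]_𝔮` — flat local with regular closed fibre `k[X]_𝔮̄` — of the tree's
`Literature.AlgebraicGeometry.Resolution.mem_pow_maximalIdeal_iff_of_isRegularLocalRing_fiber` (`OrderFlatLocalHom.lean`,
Matsumura §22); the elementary proof below needs neither the Noetherian hypothesis nor the flat slicing criterion, which is
what the consumer — a class function quantified over ALL local rings — requires.)

## Proof

`⟸` is `𝔪ⁿB ⊆ 𝔫ⁿ`. For `⟹` write `f ∈ 𝔫ⁿ` as `s · f ∈ 𝔮ⁿ` with `s ∉ 𝔮`. The image `𝔮̄` of `𝔮` in the principal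
ideal domain `k[X]` is a prime ideal. If `𝔮̄ = 0` then `𝔮 = 𝔪S[X]`, `(𝔪S[X])ⁿ = 𝔪ⁿS[X]` is read coefficientwise and
`s` has a unit coefficient (`mem_maximalIdeal_pow_of_mul_C_mem_map_C_pow`). Otherwise `𝔮̄ = (Ḡ)` with `Ḡ` monic
irreducible; lift `Ḡ` to a MONIC `F ∈ S[X]`; then `𝔮 = 𝔪S[X] + (F)` is maximal, the algebra `A = S[X]/(F)` is finite
free over `S`, integral over `S`, hence LOCAL with maximal ideal `𝔪A` (`isLocalRing_adjoinRoot_of_isMaximal`); the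
image of `s` in `A` lies outside `𝔪A`, so it is a unit, and `s·f ∈ 𝔮ⁿ` maps to `f ∈ 𝔪ⁿA`; finally
`𝔪ⁿA ∩ S = 𝔪ⁿ` by faithful flatness of the free algebra `A` (Mathlib `Ideal.comap_map_eq_self_of_faithfullyFlat`).

## Sources

* M. Nagata, *Local Rings* (1962), §18 (the local ring `S(x)`) and A. Grothendieck, EGA 0_III 10.3.1 (the algebra
  `S[X]/(F)`, `F` a monic lift of an irreducible polynomial over the residue field) — context for the construction; the
  statement as used here is ours. [folklore]
* res-L1-w43-plan-1, `CRUX-PLAN.md` §v6.8 addendum 2 + `eft_sketch_v4.lean` (clause (c10); OURS, AI planning).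
-/

noncomputable section

set_option linter.dupNamespace false -- mandated namespace `Summit.<Summit>.<Problem>` of this single-conjunct summit

open IsLocalRing Polynomial Literature.AlgebraicGeometry.Resolution

namespace Summit.ResolutionOfSingularities.ResolutionOfSingularities.Cruxes.HypersurfaceCentreConstruction.LocalEngine

universe u

variable {S : Type u} [CommRing S] [IsLocalRing S]

/-- `𝔪 S[X] ≤ 𝔮` when `𝔮 ∩ S = 𝔪`. [folklore] -/
theorem map_C_maximalIdeal_le_of_comap_C_eq {𝔮 : Ideal S[X]}
    (h𝔮 : 𝔮.comap (C : S →+* S[X]) = maximalIdeal S) : (maximalIdeal S).map (C : S →+* S[X]) ≤ 𝔮 := by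
  rw [← h𝔮]
  exact Ideal.map_comap_le

/-- **Case `𝔮 = 𝔪S[X]`** (the generic point of the fibre, Nagata's `S(X)`): if `s ∉ 𝔪S[X]` and `s · C f ∈ (𝔪S[X])ⁿ`
then `f ∈ 𝔪ⁿ` — a coefficient of `s` is a unit and `(𝔪S[X])ⁿ = 𝔪ⁿS[X]` is read coefficientwise. [folklore] -/
theorem mem_maximalIdeal_pow_of_mul_C_mem_map_C_pow {s : S[X]} (hs : s ∉ (maximalIdeal S).map (C : S →+* S[X]))
    {f : S} {n : ℕ} (hsf : s * C f ∈ (maximalIdeal S).map (C : S →+* S[X]) ^ n) : f ∈ maximalIdeal S ^ n := by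
  rw [Ideal.mem_map_C_iff] at hs
  push Not at hs
  obtain ⟨i, hi⟩ := hs
  have hunit : IsUnit (s.coeff i) := by
    by_contra h
    exact hi ((mem_maximalIdeal _).mpr h)
  rw [← Ideal.map_pow, Ideal.mem_map_C_iff] at hsf
  have := hsf i
  rw [coeff_mul_C] at this
  exact (Ideal.unit_mul_mem_iff_mem _ hunit).mp this

/-- **The finite free local algebra `S[X]/(F)`**: for a local ring `(S, 𝔪)` and a MONIC `F ∈ S[X]` such that
`J = 𝔪S[X] + (F)` is a maximal ideal of `S[X]` (i.e. `F̄ ∈ k[X]` is irreducible), the algebra `A = S[X]/(F)` is a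
local ring, its maximal ideal is `𝔪A`, and `𝔪A` pulls back to `J` along `S[X] → A`. (Every maximal ideal of the
module-finite `S`-algebra `A` contracts to `𝔪`, hence contains the maximal ideal `𝔪A`.) [folklore] -/
theorem isLocalRing_adjoinRoot_of_isMaximal {F : S[X]} (hF : F.Monic)
    (hJ : ((maximalIdeal S).map (C : S →+* S[X]) ⊔ Ideal.span {F}).IsMaximal) :
    ∃ _ : IsLocalRing (AdjoinRoot F),
      maximalIdeal (AdjoinRoot F) = (maximalIdeal S).map (algebraMap S (AdjoinRoot F)) ∧
      ((maximalIdeal S).map (algebraMap S (AdjoinRoot F))).comap (AdjoinRoot.mk F) =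
        (maximalIdeal S).map (C : S →+* S[X]) ⊔ Ideal.span {F} := by
  set 𝔪 := maximalIdeal S with h𝔪def
  set A := AdjoinRoot F with hAdef
  set θ : S[X] →+* A := AdjoinRoot.mk F with hθdef
  have hθ : Function.Surjective θ := AdjoinRoot.mk_surjective
  haveI : Module.Free S A := hF.free_adjoinRoot
  haveI : Module.Finite S A := hF.finite_adjoinRoot
  -- the ideal `I = 𝔪A`
  set I : Ideal A := 𝔪.map (algebraMap S A) with hIdef
  have hθC : θ.comp C = algebraMap S A := by
    rw [hθdef, AdjoinRoot.algebraMap_eq]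
    rfl
  have hI : I = (𝔪.map (C : S →+* S[X])).map θ := by
    rw [Ideal.map_map, hθC]
  have hkerθ : RingHom.ker θ = Ideal.span {F} := by
    ext x
    rw [RingHom.mem_ker, hθdef, AdjoinRoot.mk_eq_zero, Ideal.mem_span_singleton]
  have hmapθJ : (𝔪.map (C : S →+* S[X]) ⊔ Ideal.span {F}).map θ = I := by
    rw [Ideal.map_sup, ← hI, Ideal.map_span, Set.image_singleton]
    have : θ F = 0 := by rw [hθdef]; exact AdjoinRoot.mk_self
    rw [this, Ideal.span_singleton_eq_bot.mpr rfl, sup_bot_eq]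
  have hcomapθI : I.comap θ = 𝔪.map (C : S →+* S[X]) ⊔ Ideal.span {F} := by
    rw [← hmapθJ, Ideal.comap_map_of_surjective _ hθ, ← RingHom.ker_eq_comap_bot, hkerθ, sup_assoc, sup_idem]
  -- `I` is maximal
  have hImax : I.IsMaximal := by
    rcases Ideal.map_eq_top_or_isMaximal_of_surjective θ hθ hJ with h | h
    · exfalso
      apply hJ.ne_top
      rw [← hcomapθI, ← hmapθJ, h, Ideal.comap_top]
    · rwa [hmapθJ] at h
  -- every maximal ideal of `A` is `I` (integrality over the local ring `S`)
  haveI : Algebra.IsIntegral S A := Algebra.IsIntegral.of_finite S A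
  haveI hAloc : IsLocalRing A := by
    refine IsLocalRing.of_unique_max_ideal ⟨I, hImax, fun 𝔐 h𝔐 => ?_⟩
    haveI := h𝔐
    have h1 : (𝔐.comap (algebraMap S A)).IsMaximal := Ideal.isMaximal_comap_of_isIntegral_of_isMaximal 𝔐
    have h2 : 𝔐.comap (algebraMap S A) = 𝔪 := IsLocalRing.eq_maximalIdeal h1
    have h3 : I ≤ 𝔐 := by
      rw [hIdef, ← h2]
      exact Ideal.map_comap_le
    exact (hImax.eq_of_le h𝔐.ne_top h3).symm
  exact ⟨hAloc, (IsLocalRing.eq_maximalIdeal hImax).symm, hcomapθI⟩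

/-- **Key lemma**: let `(S, 𝔪)` be a local ring, `𝔮 ⊂ S[X]` a prime ideal with `𝔮 ∩ S = 𝔪`, `s ∉ 𝔮` and `f ∈ S`
with `s · C f ∈ 𝔮ⁿ`. Then `f ∈ 𝔪ⁿ`. Equivalently `𝔮ⁿS[X]_𝔮 ∩ S ⊆ 𝔪ⁿ`: the order of an element of `S` does not
grow in the local rings of `𝔸¹_S` at the points over the closed point. [folklore] -/
theorem mem_maximalIdeal_pow_of_mul_C_mem_pow (𝔮 : Ideal S[X]) [𝔮.IsPrime]
    (h𝔮 : 𝔮.comap (C : S →+* S[X]) = maximalIdeal S) {s : S[X]} (hs : s ∉ 𝔮) {f : S} {n : ℕ}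
    (hsf : s * C f ∈ 𝔮 ^ n) : f ∈ maximalIdeal S ^ n := by
  set 𝔪 := maximalIdeal S with h𝔪def
  set k := ResidueField S
  set π : S →+* k := residue S
  have hπ : Function.Surjective π := residue_surjective
  set πX : S[X] →+* k[X] := mapRingHom π with hπXdef
  have hπX : Function.Surjective πX := map_surjective π hπ
  have hkerπX : RingHom.ker πX = 𝔪.map (C : S →+* S[X]) := by
    rw [hπXdef, ker_mapRingHom, ker_residue]
  have h𝔪𝔮 : 𝔪.map (C : S →+* S[X]) ≤ 𝔮 := map_C_maximalIdeal_le_of_comap_C_eq h𝔮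
  have hker𝔮 : RingHom.ker πX ≤ 𝔮 := hkerπX ▸ h𝔪𝔮
  -- the image prime of `k[X]`
  set 𝔮' : Ideal k[X] := 𝔮.map πX with h𝔮'def
  haveI h𝔮'p : 𝔮'.IsPrime := Ideal.map_isPrime_of_surjective hπX hker𝔮
  have hcomap𝔮' : 𝔮'.comap πX = 𝔮 := by
    rw [h𝔮'def, Ideal.comap_map_of_surjective _ hπX, ← RingHom.ker_eq_comap_bot]
    exact sup_eq_left.mpr hker𝔮
  -- `k[X]` is a principal ideal ring
  obtain ⟨G, hG⟩ : ∃ G : k[X], 𝔮' = Ideal.span {G} :=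
    ⟨_, (Submodule.IsPrincipal.span_singleton_generator 𝔮').symm⟩
  by_cases hG0 : G = 0
  · -- Case A: `𝔮 = 𝔪S[X]`
    have h𝔮eq : 𝔮 = 𝔪.map (C : S →+* S[X]) := by
      refine le_antisymm ?_ h𝔪𝔮
      rw [← hcomap𝔮', hG, hG0, Ideal.span_singleton_eq_bot.mpr rfl, ← RingHom.ker_eq_comap_bot, hkerπX]
    rw [h𝔮eq] at hs hsf
    exact mem_maximalIdeal_pow_of_mul_C_mem_map_C_pow hs hsf
  · -- Case B: `𝔮' = (G)`, `G ≠ 0`; normalise to a monic generator and lift it to a monic `F ∈ S[X]`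
    set G₁ : k[X] := G * C (G.leadingCoeff)⁻¹ with hG₁def
    have hG₁ : G₁.Monic := monic_mul_leadingCoeff_inv hG0
    have hspan : Ideal.span {G₁} = 𝔮' := by
      rw [hG, hG₁def]
      exact Ideal.span_singleton_mul_right_unit (isUnit_C.mpr (IsUnit.inv (isUnit_iff_ne_zero.mpr
        (leadingCoeff_ne_zero.mpr hG0)))) G
    obtain ⟨F, hFmap, -, hF⟩ := lifts_and_degree_eq_and_monic ((mem_lifts G₁).mpr (hπX G₁)) hG₁
    -- `𝔮 = 𝔪S[X] + (F)`
    have h𝔮J : 𝔮 = 𝔪.map (C : S →+* S[X]) ⊔ Ideal.span {F} := by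
      rw [← hcomap𝔮', ← hspan, show G₁ = πX F from by rw [hπXdef, coe_mapRingHom, hFmap], ← Set.image_singleton,
        ← Ideal.map_span, Ideal.comap_map_of_surjective _ hπX, ← RingHom.ker_eq_comap_bot, hkerπX, sup_comm]
    -- `𝔮` is maximal (`𝔮'` is a non-zero prime of the PID `k[X]`)
    have h𝔮'ne : 𝔮' ≠ ⊥ := by
      rw [hG, Ne, Ideal.span_singleton_eq_bot]
      exact hG0
    have h𝔮'max : 𝔮'.IsMaximal := IsPrime.to_maximal_ideal h𝔮'ne
    have h𝔮max : 𝔮.IsMaximal := by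
      rw [← hcomap𝔮']
      exact Ideal.comap_isMaximal_of_surjective πX hπX
    have hJmax : (𝔪.map (C : S →+* S[X]) ⊔ Ideal.span {F}).IsMaximal := h𝔮J ▸ h𝔮max
    -- `F` has positive degree (`𝔮 ≠ ⊤`)
    have hF0 : F.natDegree ≠ 0 := by
      intro h0
      have hF1 : F = 1 := by
        rw [← hF.natDegree_eq_zero]
        exact h0
      apply h𝔮max.ne_top
      rw [h𝔮J, hF1, Ideal.span_singleton_one]
      exact sup_top_eq _
    -- the algebra `A = S[X]/(F)`: finite free, local with maximal ideal `𝔪A`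
    obtain ⟨hAloc, hmaxA, hcomapθI⟩ := isLocalRing_adjoinRoot_of_isMaximal hF hJmax
    set A := AdjoinRoot F with hAdef
    set θ : S[X] →+* A := AdjoinRoot.mk F with hθdef
    haveI : Module.Free S A := hF.free_adjoinRoot
    haveI : Nontrivial A := by
      rw [hAdef, AdjoinRoot, Ideal.Quotient.nontrivial_iff, Ne, Ideal.span_singleton_eq_top, hF.isUnit_iff]
      intro hF1
      exact hF0 (by rw [hF1, natDegree_one])
    set I : Ideal A := 𝔪.map (algebraMap S A) with hIdef
    -- `θ s` is a unit of the local ring `A`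
    have hθs : IsUnit (θ s) := by
      by_contra hns
      have hmem : θ s ∈ maximalIdeal A := (mem_maximalIdeal _).mpr hns
      rw [hmaxA, ← Ideal.mem_comap, hcomapθI, ← h𝔮J] at hmem
      exact hs hmem
    -- push `s · C f ∈ 𝔮ⁿ` to `A` and cancel the unit
    have hmapθ𝔮 : 𝔮.map θ ≤ I := by
      rw [h𝔮J, Ideal.map_le_iff_le_comap, hcomapθI]
    have h1 : θ s * algebraMap S A f ∈ I ^ n := by
      have hmem : θ (s * C f) ∈ (𝔮 ^ n).map θ := Ideal.mem_map_of_mem θ hsf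
      rw [map_mul, Ideal.map_pow, hθdef, AdjoinRoot.mk_C] at hmem
      exact Ideal.pow_right_mono hmapθ𝔮 n hmem
    have h2 : algebraMap S A f ∈ (𝔪 ^ n).map (algebraMap S A) := by
      rw [Ideal.map_pow]
      exact (Ideal.unit_mul_mem_iff_mem _ hθs).mp h1
    -- faithful flatness of the free algebra `A`
    have h3 : f ∈ ((𝔪 ^ n).map (algebraMap S A)).comap (algebraMap S A) := Ideal.mem_comap.mpr h2
    rwa [Ideal.comap_map_eq_self_of_faithfullyFlat] at h3

/-- Localization form: for a local ring `(S, 𝔪)`, a prime `𝔮 ⊂ S[X]` with `𝔮 ∩ S = 𝔪`, a localization `B` of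
`S[X]` at `𝔮` and `f ∈ S`: `f ∈ 𝔫_Bⁿ ⟹ f ∈ 𝔪ⁿ`. [folklore] -/
theorem mem_maximalIdeal_pow_of_algebraMap_C_mem_pow (𝔮 : Ideal S[X]) [𝔮.IsPrime]
    (h𝔮 : 𝔮.comap (C : S →+* S[X]) = maximalIdeal S) (B : Type*) [CommRing B] [Algebra S[X] B]
    [IsLocalization.AtPrime B 𝔮] [IsLocalRing B] {f : S} {n : ℕ}
    (hf : algebraMap S[X] B (C f) ∈ maximalIdeal B ^ n) : f ∈ maximalIdeal S ^ n := by
  have hmax : maximalIdeal B = 𝔮.map (algebraMap S[X] B) :=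
    (IsLocalization.AtPrime.map_eq_maximalIdeal 𝔮 B).symm
  rw [hmax, ← Ideal.map_pow, IsLocalization.algebraMap_mem_map_algebraMap_iff 𝔮.primeCompl] at hf
  obtain ⟨s, hs, hsf⟩ := hf
  exact mem_maximalIdeal_pow_of_mul_C_mem_pow 𝔮 h𝔮 hs hsf

/-- The trivial direction: `f ∈ 𝔪ⁿ ⟹ f ∈ 𝔫_Bⁿ` (`𝔪S[X] ⊆ 𝔮`, so `𝔪ⁿB ⊆ 𝔫ⁿ`). [folklore] -/
theorem algebraMap_C_mem_pow_of_mem_maximalIdeal_pow (𝔮 : Ideal S[X]) [𝔮.IsPrime]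
    (h𝔮 : 𝔮.comap (C : S →+* S[X]) = maximalIdeal S) (B : Type*) [CommRing B] [Algebra S[X] B]
    [IsLocalization.AtPrime B 𝔮] [IsLocalRing B] {f : S} {n : ℕ} (hf : f ∈ maximalIdeal S ^ n) :
    algebraMap S[X] B (C f) ∈ maximalIdeal B ^ n := by
  have h1 : C f ∈ 𝔮 ^ n :=
    Ideal.pow_right_mono (map_C_maximalIdeal_le_of_comap_C_eq h𝔮) n
      (by rw [← Ideal.map_pow]; exact Ideal.mem_map_of_mem _ hf)
  have h2 := Ideal.mem_map_of_mem (algebraMap S[X] B) h1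
  rwa [Ideal.map_pow, IsLocalization.AtPrime.map_eq_maximalIdeal 𝔮 B] at h2

/-- **`f ∈ 𝔫_Bⁿ ⟺ f ∈ 𝔪ⁿ`** for `f ∈ S`, `B = S[X]_𝔮`, `𝔮 ∩ S = 𝔪`. [folklore] -/
theorem algebraMap_C_mem_pow_iff (𝔮 : Ideal S[X]) [𝔮.IsPrime]
    (h𝔮 : 𝔮.comap (C : S →+* S[X]) = maximalIdeal S) (B : Type*) [CommRing B] [Algebra S[X] B]
    [IsLocalization.AtPrime B 𝔮] [IsLocalRing B] (f : S) (n : ℕ) :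
    algebraMap S[X] B (C f) ∈ maximalIdeal B ^ n ↔ f ∈ maximalIdeal S ^ n :=
  ⟨mem_maximalIdeal_pow_of_algebraMap_C_mem_pow 𝔮 h𝔮 B, algebraMap_C_mem_pow_of_mem_maximalIdeal_pow 𝔮 h𝔮 B⟩

/-- **The order is unchanged**: `ord_{𝔫_B}(f) = ord_𝔪(f)` (the tree's `adicOrder`, `ℕ∞`-valued) for `f ∈ S`,
`B = S[X]_𝔮` a local ring of `𝔸¹_S` at a point over the closed point. [folklore] -/
theorem adicOrder_algebraMap_C (𝔮 : Ideal S[X]) [𝔮.IsPrime]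
    (h𝔮 : 𝔮.comap (C : S →+* S[X]) = maximalIdeal S) (B : Type*) [CommRing B] [Algebra S[X] B]
    [IsLocalization.AtPrime B 𝔮] [IsLocalRing B] (f : S) :
    adicOrder (algebraMap S[X] B (C f)) = adicOrder f := by
  refine le_antisymm ?_ ?_
  · refine ENat.forall_natCast_le_iff_le.mp fun n hn => ?_
    rw [le_adicOrder_iff] at hn ⊢
    exact mem_maximalIdeal_pow_of_algebraMap_C_mem_pow 𝔮 h𝔮 B hn
  · refine ENat.forall_natCast_le_iff_le.mp fun n hn => ?_
    rw [le_adicOrder_iff] at hn ⊢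
    exact algebraMap_C_mem_pow_of_mem_maximalIdeal_pow 𝔮 h𝔮 B hn

end Summit.ResolutionOfSingularities.ResolutionOfSingularities.Cruxes.HypersurfaceCentreConstruction.LocalEngine

end
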